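import Mathlib
import Literature.NumberTheory.LFunctions.Zhang2022.Section14Eq148Leg1
import Literature.NumberTheory.LFunctions.Zhang2022.Section14Prop141Twisted
import Literature.NumberTheory.LFunctions.Zhang2022.ToolkitLemma56BetaTwist
import HarnessLib

/-!
# Zhang (2022) §14, (14.8) first `r`-range at GENERAL `β` (the weight `(pt₀)^β` of Proposition 14.1):
# the twisted u017 majorant on `r < D³` is `≪ P²D^{−1}` — kernel-checked

Topic `Literature/NumberTheory/LFunctions/Zhang2022` (Landau–Siegel audit tree; verdict-neutral).
Y. Zhang, *Discrete mean estimates and the Landau–Siegel zero*, arXiv:2211.02515v1 (2022)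
[Zhang2022LandauSiegel] — **an unrefereed manuscript under adjudication; nothing here asserts or denies
its Theorems 1–2 or Proposition 14.1.** ZHANG-L discharge lane (WP14; helper under the leaf
`Skeleton.Prop141` at general `β`, `‖β‖ < 5α` — GAP rows G-L3t7-1 ("the general case is almost
identical", p. 76, no argument printed) and G-adj2-4 (the (14.8) legs); the W-leg1 item of the lane's
Prop. 14.1 work list).

The manuscript proves Proposition 14.1 at `β = 0` only. At general `β` the parameter enters `Θ₂` and the
main term only through the bounded per-modulus weight `(pt₀)^β` (`Typed.Sec14.wt`, `‖(pt₀)^β‖ ≤ e^{15π}`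
for `‖β‖ ≤ 5α`, `norm_wt_le`), so the (14.8) majorant acquires the twist inside its `p`-sum
(`Typed.Sec14.rhs1417OnW`, `Section14Prop141Twisted`). This file is the twisted twin of
`Section14Eq148Leg1` (the `β = 0` leg `eq148leg1_holds`): the SAME generic `l`-series lemma
`norm_tsum_le_of_perTerm` (arbitrary prime weight) is fed with

* the β-twisted Lemma 5.6 for `χθ̄` (`Skeleton.lemma56_chi_mul_inv_beta`, `ToolkitLemma56BetaTwist`: the real
  part of `β` by Abel summation over sub-windows, the imaginary part merged into the height `|t| ≤ D − 1`),
  through the tree's exact-weight Mellin bound `Skeleton.norm_sum_primeWindow_mul_DeltaW_le_of_bounds`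
  (Lemma 5.4 (i) on `|t| ≤ D/2`, rapid decay of `δ(1+it)` beyond) — `norm_primeSum_chi_inv_wt_DeltaW_le`;
* `A₀ = e^{15π}` in the Lemma-5.3 tail — `smallConductor_tsum_le_wt`;
* the `(d, r, h, θ)`-aggregation of `eq148leg1_holds`, verbatim, on the CLOSED range `Icc 2 ⌊2DP₄⌋` of the
  weighted re-indexing — `eq148leg1W_holds` (`c = C = 1`).

| decl | content |
|---|---|
| `norm_primeSum_chi_inv_wt_DeltaW_le` | `‖Σ_{p∼P} χθ̄(p)(pt₀)^βΔ(l/(phr))‖ ≤ K·P²·D^{−A}·hr/l` (`1 < r < D³`, `θ` primitive, `θ ≠ χ`, `|β| ≤ 5α`) |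
| `smallConductor_tsum_le_wt` | `‖Σ_l u(l)‖ ≤ C·d(d)⁴·hr·P²·D^{−A}` for any series dominated by `|κ*(dl)|·|Σ_p χθ̄(p)(pt₀)^βΔ(l/(phr))|` |
| `eq148leg1W_holds` | `rhs1417OnW χ β κ* ((Icc 2 ⌊2DP₄⌋).filter (r < D³)) ≤ P²·D^{−1}` eventually, all `‖β‖ < 5α` |

Theorems only; no new definitions, no new named facts; inputs are tree theorems (Lemmas 5.3, 5.4 (i), 5.6
discharged). NOT here: the large-conductor range `r ≥ D³` (large sieve), the weighted re-indexing, (14.5)ᵂ,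
(14.6)ᵂ, Proposition 14.1 itself, Theorems 1–2, or anything about Landau–Siegel zeros.

## References

* Y. Zhang, arXiv:2211.02515v1 (2022), §14 Prop. 14.1 p. 76 (tex L3841–L3849), (14.8) and its proof
  sentence p. 79 (tex L3945–L3962); §5 Lemmas 5.3, 5.4, 5.6 pp. 25–26.
  [cite: Zhang2022LandauSiegel, §14 Prop. 14.1 p.76, (14.8) p.79]
-/

noncomputable section

open Complex Real

namespace Literature.NumberTheory.LFunctions.Zhang2022.Typed.Sec14

open Skeleton

/-! ## The per-term Mellin bound for the twisted weight `χθ̄(p)(pt₀)^β`, any power of `D` -/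

/-- **Per-term bound with arbitrary power saving, twisted by `(pt₀)^β`** (Prop. 14.1 at general
`β`, "the general case is almost identical", p. 76): for every `A` there is `K ≥ 0` such that, for all
large `D` under (A), all `|β| ≤ 5α`, `1 < r < D³`, `θ` primitive `(mod r)` with `θ ≠ χ` (mod `Dr`),
`h, l ≥ 1`: `‖Σ_{p∼P} χ(p)θ̄(p)(pt₀)^β Δ(l/(p·hr))‖ ≤ K·P²·D^{−A}·(hr)/l`. Route: the tree's exact-weight
Mellin bound `Skeleton.norm_sum_primeWindow_mul_DeltaW_le_of_bounds` with the β-twisted Lemma-5.6 input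
`Skeleton.lemma56_chi_mul_inv_beta` (`Dr < D⁴ ≤ T`, `|t| ≤ D/2 ≤ D − 1`) and the trivial bound
`‖Σ_{p∼P} χθ̄(p)(pt₀)^β p^{1+it}‖ ≤ e^{15π}𝔓 ≤ 4e^{15π}P²` (`norm_wt_le`).
[cite: Zhang2022LandauSiegel, §14 Prop. 14.1 p.76, (14.8) p.79, tex L3960–L3962; §5 Lemmas 5.4, 5.6] -/
theorem norm_primeSum_chi_inv_wt_DeltaW_le (A : ℕ) :
    ∃ K : ℝ, 0 ≤ K ∧ ForAllLarge fun D _ χ => AssumptionA D χ → ∀ β : ℂ, ‖β‖ ≤ 5 * alpha D →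
      ∀ (r h l : ℕ) (θ : DirichletCharacter ℂ r), 1 < r → (r : ℝ) < (D : ℝ) ^ 3 → 0 < h → 0 < l →
        θ.IsPrimitive →
        DirichletCharacter.changeLevel (dvd_mul_left r D) θ ≠
          DirichletCharacter.changeLevel (dvd_mul_right D r) χ →
        ‖∑ p ∈ primeWindow D, χ (p : ZMod D) * θ⁻¹ (p : ZMod r) * wt D β p *
            DeltaW D ((l : ℝ) / ((p : ℝ) * ((h * r : ℕ) : ℝ)))‖
          ≤ K * bigP D ^ 2 * (D : ℝ) ^ (-(A : ℝ)) * ((h * r : ℕ) : ℝ) / l := by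
  obtain ⟨CM, hM⟩ := norm_sum_primeWindow_mul_DeltaW_le_of_bounds A
  obtain ⟨C56, hC56, h56⟩ := lemma56_chi_mul_inv_beta
  obtain ⟨D3, hℓ3⟩ := exists_nat_forall_le_ell 3
  obtain ⟨DP, hP4⟩ := frakP_le_four_mul_bigP_sq
  obtain ⟨DT, hT⟩ := pow_four_le_bigT
  obtain ⟨Dℓ, hℓA⟩ := exists_nat_forall_le_ell ((A : ℝ) + 1)
  obtain ⟨D₀, hall⟩ := hM.and h56
  set K : ℝ := max CM 0 * ((C56 * (Nat.factorial 2595 : ℝ) + Real.exp (15 * π)) * 4) with hK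
  refine ⟨K, by positivity, D₀ + DP + DT + Dℓ + D3 + 3,
    fun D _ χ hD hq hp hA β hβ r h l θ hr hrD hh hl hθ hne => ?_⟩
  obtain ⟨hMD, h56D⟩ := hall D χ (by omega) hq hp
  have hD3 : 3 ≤ D := by omega
  have hℓ3' : 3 ≤ ell D := hℓ3 D (by omega)
  have hD0 : (0 : ℝ) < D := by exact_mod_cast (show 0 < D by omega)
  haveI : NeZero r := ⟨by omega⟩
  have hr0 : (0 : ℝ) < r := by exact_mod_cast (show 0 < r by omega)
  -- `Dr < D⁴ ≤ T`
  have hDrT : (D : ℝ) * r < bigT D := by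
    calc (D : ℝ) * r < (D : ℝ) * (D : ℝ) ^ 3 := mul_lt_mul_of_pos_left hrD hD0
      _ = (D : ℝ) ^ 4 := by ring
      _ ≤ bigT D := hT D (by omega)
  -- the coefficients `a(p) = χ(p)θ̄(p)(pt₀)^β` and their prime-sum bounds
  set a : ℕ → ℂ := fun p => χ (p : ZMod D) * θ⁻¹ (p : ZMod r) * wt D β p with ha
  have hW0 : 0 ≤ Real.exp (15 * π) := (Real.exp_pos _).le
  have hP0 : 0 ≤ frakP D := by
    rw [frakP_eq_sum_primeWindow]; exact Finset.sum_nonneg fun p _ => Nat.cast_nonneg p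
  set E : ℝ := C56 * frakP D * Real.exp (-(ell D ^ ((9 : ℝ) / 2))) with hE
  have hE0 : 0 ≤ E := by positivity
  have hFb : ∀ t : ℝ, ‖∑ p ∈ primeWindow D, a p * (p : ℂ) ^ (1 + (t : ℂ) * I)‖ ≤
      Real.exp (15 * π) * frakP D := by
    intro t
    rw [frakP_eq_sum_primeWindow, Finset.mul_sum]
    refine (norm_sum_le _ _).trans (Finset.sum_le_sum fun p hpw => ?_)
    have hpp : 0 < p := (Finset.mem_filter.mp hpw).2.pos
    have hre : (1 + (t : ℂ) * I).re = 1 := by simp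
    rw [norm_mul, Complex.norm_natCast_cpow_of_pos hpp, hre, Real.rpow_one, ha, norm_mul, norm_mul]
    have h1 : ‖χ (p : ZMod D)‖ ≤ 1 := DirichletCharacter.norm_le_one _ _
    have h2 : ‖θ⁻¹ (p : ZMod r)‖ ≤ 1 := DirichletCharacter.norm_le_one _ _
    have h3 : ‖wt D β p‖ ≤ Real.exp (15 * π) := norm_wt_le hℓ3' hpw hβ
    calc ‖χ (p : ZMod D)‖ * ‖θ⁻¹ (p : ZMod r)‖ * ‖wt D β p‖ * (p : ℝ)
        ≤ 1 * 1 * Real.exp (15 * π) * p := by gcongr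
      _ = Real.exp (15 * π) * p := by ring
  have hEb : ∀ t : ℝ, |t| ≤ (D : ℝ) / 2 →
      ‖∑ p ∈ primeWindow D, a p * (p : ℂ) ^ (1 + (t : ℂ) * I)‖ ≤ E := by
    intro t ht
    have hD3r : (3 : ℝ) ≤ D := by exact_mod_cast hD3
    have htD : |t| ≤ (D : ℝ) - 1 := ht.trans (by linarith)
    exact h56D hA r hr hDrT θ hθ hne β hβ t htD
  -- the exact-weight Mellin bound at `c₀ = l/(hr)`
  have hhr0 : (0 : ℝ) < ((h * r : ℕ) : ℝ) := by exact_mod_cast Nat.mul_pos hh (by omega)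
  have hl0 : (0 : ℝ) < l := by exact_mod_cast hl
  have hc₀ : 0 < (l : ℝ) / ((h * r : ℕ) : ℝ) := div_pos hl0 hhr0
  have hmain := hMD a _ E (Real.exp (15 * π) * frakP D) hc₀ hE0 (by positivity) hEb hFb
  have harg : ∀ p : ℕ, (l : ℝ) / ((h * r : ℕ) : ℝ) / (p : ℝ) = (l : ℝ) / ((p : ℝ) * ((h * r : ℕ) : ℝ)) := by
    intro p; rw [div_div, mul_comm]
  simp_rw [harg] at hmain
  -- sizes of the two terms
  have hℓ' : (A : ℝ) + 1 ≤ ell D := hℓA D (by omega)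
  have hexp := ell_pow_5190_mul_exp_neg_le hD3 A hℓ'
  have hDA0 : 0 ≤ (D : ℝ) ^ (-(A : ℝ)) := Real.rpow_nonneg hD0.le _
  have hQ : E * ell D ^ 5190 + Real.exp (15 * π) * frakP D * (D : ℝ) ^ (-(A : ℝ)) ≤
      (C56 * (Nat.factorial 2595 : ℝ) + Real.exp (15 * π)) * 4 * (bigP D ^ 2 * (D : ℝ) ^ (-(A : ℝ))) := by
    have h1 : E * ell D ^ 5190 ≤
        C56 * frakP D * ((Nat.factorial 2595 : ℝ) * (D : ℝ) ^ (-(A : ℝ))) := by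
      rw [hE]
      calc C56 * frakP D * Real.exp (-(ell D ^ ((9 : ℝ) / 2))) * ell D ^ 5190
          = C56 * frakP D * (ell D ^ 5190 * Real.exp (-(ell D ^ ((9 : ℝ) / 2)))) := by ring
        _ ≤ _ := mul_le_mul_of_nonneg_left hexp (by positivity)
    have hP4' := hP4 D (by omega)
    have h2 : C56 * frakP D * ((Nat.factorial 2595 : ℝ) * (D : ℝ) ^ (-(A : ℝ))) +
        Real.exp (15 * π) * frakP D * (D : ℝ) ^ (-(A : ℝ)) =
        (C56 * (Nat.factorial 2595 : ℝ) + Real.exp (15 * π)) * (frakP D * (D : ℝ) ^ (-(A : ℝ))) := by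
      ring
    calc E * ell D ^ 5190 + Real.exp (15 * π) * frakP D * (D : ℝ) ^ (-(A : ℝ))
        ≤ (C56 * (Nat.factorial 2595 : ℝ) + Real.exp (15 * π)) *
            (frakP D * (D : ℝ) ^ (-(A : ℝ))) := by
          rw [← h2]; exact add_le_add h1 le_rfl
      _ ≤ (C56 * (Nat.factorial 2595 : ℝ) + Real.exp (15 * π)) *
            (4 * bigP D ^ 2 * (D : ℝ) ^ (-(A : ℝ))) := by
          refine mul_le_mul_of_nonneg_left ?_ (by positivity)
          exact mul_le_mul_of_nonneg_right hP4' hDA0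
      _ = _ := by ring
  have hQ0 : 0 ≤ E * ell D ^ 5190 + Real.exp (15 * π) * frakP D * (D : ℝ) ^ (-(A : ℝ)) := by
    positivity
  have hinv : ((l : ℝ) / ((h * r : ℕ) : ℝ))⁻¹ = ((h * r : ℕ) : ℝ) / l := inv_div _ _
  rw [hinv] at hmain
  have hhrl0 : 0 ≤ ((h * r : ℕ) : ℝ) / l := by positivity
  calc ‖∑ p ∈ primeWindow D, a p * DeltaW D ((l : ℝ) / ((p : ℝ) * ((h * r : ℕ) : ℝ)))‖
      ≤ CM * (((h * r : ℕ) : ℝ) / l) * (E * ell D ^ 5190 + Real.exp (15 * π) * frakP D * (D : ℝ) ^ (-(A : ℝ))) := hmain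
    _ ≤ max CM 0 * (((h * r : ℕ) : ℝ) / l) * (E * ell D ^ 5190 + Real.exp (15 * π) * frakP D * (D : ℝ) ^ (-(A : ℝ))) := by
        have : 0 ≤ (((h * r : ℕ) : ℝ) / l) * (E * ell D ^ 5190 + Real.exp (15 * π) * frakP D * (D : ℝ) ^ (-(A : ℝ))) :=
          mul_nonneg hhrl0 hQ0
        calc CM * (((h * r : ℕ) : ℝ) / l) * (E * ell D ^ 5190 + Real.exp (15 * π) * frakP D * (D : ℝ) ^ (-(A : ℝ)))
            = CM * ((((h * r : ℕ) : ℝ) / l) * (E * ell D ^ 5190 + Real.exp (15 * π) * frakP D * (D : ℝ) ^ (-(A : ℝ)))) := by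
              ring
          _ ≤ max CM 0 * ((((h * r : ℕ) : ℝ) / l) *
                (E * ell D ^ 5190 + Real.exp (15 * π) * frakP D * (D : ℝ) ^ (-(A : ℝ)))) :=
              mul_le_mul_of_nonneg_right (le_max_left _ _) this
          _ = _ := by ring
    _ ≤ max CM 0 * (((h * r : ℕ) : ℝ) / l) *
          ((C56 * (Nat.factorial 2595 : ℝ) + Real.exp (15 * π)) * 4 * (bigP D ^ 2 * (D : ℝ) ^ (-(A : ℝ)))) :=
        mul_le_mul_of_nonneg_left hQ (mul_nonneg (le_max_right _ _) hhrl0)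
    _ = K * bigP D ^ 2 * (D : ℝ) ^ (-(A : ℝ)) * ((h * r : ℕ) : ℝ) / l := by
        rw [hK]; ring

/-! ## One character of small conductor, twisted: the `l`-series with a power saving -/

/-- **The twisted `l`-series at a character of conductor `< D³`, any power of `D`.** For every `A`,
`B` there is `C ≥ 0` such that for all large `D` under (A), all `|β| ≤ 5α`, all `κ*` with (14.1)
(constant `B`), all `d`, all `1 < r < D³`, `h ≥ 1` with `hr ≤ P`, every primitive `θ (mod r)` with
`θ ≠ χ` (mod `Dr`), and every series `Σ_l u(l)` dominated by `|κ*(dl)|·|Σ_{p∼P} χθ̄(p)(pt₀)^β Δ(l/(p·hr))|`: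
`‖Σ_l u(l)‖ ≤ C·d(d)⁴·hr·P²·D^{−A}` (the generic `norm_tsum_le_of_perTerm` with `A₀ = e^{15π}`, the
twisted per-term bound at `A+1`, Lemma 5.3 for the tail).
[cite: Zhang2022LandauSiegel, §14 Prop. 14.1 p.76, (14.8) p.79, tex L3960–L3962; §5 Lemmas 5.3, 5.4, 5.6] -/
theorem smallConductor_tsum_le_wt (A : ℕ) (B : ℝ) :
    ∃ C : ℝ, 0 ≤ C ∧ ForAllLarge fun D _ χ => AssumptionA D χ → ∀ β : ℂ, ‖β‖ ≤ 5 * alpha D →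
      ∀ κs : ℕ → ℂ, Eq141 B κs →
      ∀ (d r h : ℕ) (θ : DirichletCharacter ℂ r), 1 < r → (r : ℝ) < (D : ℝ) ^ 3 → 0 < h →
        ((h * r : ℕ) : ℝ) ≤ bigP D → θ.IsPrimitive →
        DirichletCharacter.changeLevel (dvd_mul_left r D) θ ≠
          DirichletCharacter.changeLevel (dvd_mul_right D r) χ →
        ∀ u : ℕ → ℂ, (∀ l : ℕ, ‖u l‖ ≤ ‖κs (d * l)‖ *
          ‖∑ p ∈ primeWindow D, χ (p : ZMod D) * θ⁻¹ (p : ZMod r) * wt D β p *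
              DeltaW D ((l : ℝ) / ((p : ℝ) * ((h * r : ℕ) : ℝ)))‖) →
        ‖∑' l : ℕ, u l‖ ≤ C * (d.divisors.card : ℝ) ^ 4 * ((h * r : ℕ) : ℝ) * bigP D ^ 2 *
          (D : ℝ) ^ (-(A : ℝ)) := by
  obtain ⟨K, hK0, DK, hK⟩ := norm_primeSum_chi_inv_wt_DeltaW_le (A + 1)
  obtain ⟨D3, hℓ3⟩ := exists_nat_forall_le_ell 3
  obtain ⟨c53, hc53, C53, D53, h53⟩ := lemma53_holds
  obtain ⟨Dabs, habs⟩ := exists_mul_ell_pow_le 144 (show (0 : ℝ) ≤ 534 ^ 16 by positivity)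
  obtain ⟨DA, hDA⟩ := pow_le_bigP A
  obtain ⟨Dℓ, hℓ2⟩ := exists_nat_forall_le_ell 2
  set B₀ : ℝ := max B 0 with hB₀
  set C₀ : ℝ := max C53 0 with hC₀
  refine ⟨B₀ * (K + 12 * Real.exp (15 * π) * C₀), by positivity, DK + D53 + Dabs + DA + Dℓ + D3 + 3,
    fun D _ χ hD hq hp hA β hβ κs hκ d r h θ hr hrD hh hhrP hθ hne u hu => ?_⟩
  have hD3 : 3 ≤ D := by omega
  have hD0 : (0 : ℝ) < D := by exact_mod_cast (show 0 < D by omega)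
  have hℓ2' : 2 ≤ ell D := hℓ2 D (by omega)
  have hℓ1 : 1 ≤ ell D := by linarith
  have hℓ3' : 3 ≤ ell D := hℓ3 D (by omega)
  have hP0 : 0 < bigP D := Real.exp_pos _
  have hW0 : 0 ≤ Real.exp (15 * π) := (Real.exp_pos _).le
  -- (14.1) with the non-negative constant `B₀`
  have hκ₀ : Eq141 B₀ κs := fun m =>
    (hκ m).trans (mul_le_mul_of_nonneg_right (le_max_left _ _) (Nat.cast_nonneg _))
  -- Lemma 5.3 (5.9) at `D`, with the non-negative constant `C₀`
  have ht0 : 0 < t0 D ^ (1.02 : ℝ) := Real.rpow_pos_of_pos (by rw [t0]; positivity) _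
  have h59 : ∀ x : ℝ, t0 D ^ (1.02 : ℝ) < x → ‖DeltaW D x‖ ≤
      C₀ * (Real.exp (-((1 : ℝ) / 100 * ell2 D * Real.log x) ^ 2) +
        Real.exp (-(x ^ (0.99 : ℝ)) / ell2 D)) := by
    intro x hx
    have hx0 : 0 < x := ht0.trans hx
    have h1 := (h53 D χ (by omega) hq hp x hx0).2 hx
    exact h1.trans (mul_le_mul_of_nonneg_right (le_max_left _ _) (by positivity))
  -- the scale `X = hr` and the weight `a = χθ̄`
  have hX1 : (1 : ℝ) ≤ ((h * r : ℕ) : ℝ) := by exact_mod_cast Nat.mul_pos hh (by omega)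
  have ha : ∀ p ∈ primeWindow D, ‖χ (p : ZMod D) * θ⁻¹ (p : ZMod r) * wt D β p‖ ≤
      Real.exp (15 * π) := by
    intro p hpw
    rw [norm_mul, norm_mul]
    have h3 : ‖wt D β p‖ ≤ Real.exp (15 * π) := norm_wt_le hℓ3' hpw hβ
    calc ‖χ (p : ZMod D)‖ * ‖θ⁻¹ (p : ZMod r)‖ * ‖wt D β p‖ ≤ 1 * 1 * Real.exp (15 * π) := by
          gcongr <;> exact DirichletCharacter.norm_le_one _ _
      _ = Real.exp (15 * π) := by ring
  set G : ℝ := K * bigP D ^ 2 * (D : ℝ) ^ (-((A + 1 : ℕ) : ℝ)) with hG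
  have hG0 : 0 ≤ G := by positivity
  have hGl : ∀ l : ℕ, 1 ≤ l →
      ‖∑ p ∈ primeWindow D, χ (p : ZMod D) * θ⁻¹ (p : ZMod r) * wt D β p *
          DeltaW D ((l : ℝ) / ((p : ℝ) * ((h * r : ℕ) : ℝ)))‖ ≤ G * ((h * r : ℕ) : ℝ) / l :=
    fun l hl => hK D χ (by omega) hq hp hA β hβ r h l θ hr hrD hh hl hθ hne
  -- the generic `l`-series bound
  have hmain := norm_tsum_le_of_perTerm hD3 hℓ2' (le_max_right _ _) h59 (le_max_right _ _) hκ₀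
    hX1 hhrP hW0 ha hG0 hGl d hu
  -- absorbing `534¹⁶𝓛¹⁴⁴ ≤ D` and `P·D^A ≤ P²·X`
  set X : ℝ := ((h * r : ℕ) : ℝ) with hX
  have hX0 : 0 ≤ X := by linarith
  have hDA0 : 0 ≤ (D : ℝ) ^ (-(A : ℝ)) := Real.rpow_nonneg hD0.le _
  have hsplit : (D : ℝ) ^ (-((A + 1 : ℕ) : ℝ)) = (D : ℝ) ^ (-(A : ℝ)) * ((D : ℝ))⁻¹ := by
    rw [show (-((A + 1 : ℕ) : ℝ)) = (-(A : ℝ)) + (-1) by push_cast; ring, Real.rpow_add hD0,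
      Real.rpow_neg_one]
  have hhead : G * X * (534 * ell D ^ 9) ^ 16 ≤ K * (X * bigP D ^ 2 * (D : ℝ) ^ (-(A : ℝ))) := by
    have habs' : 534 ^ 16 * ell D ^ 144 ≤ D := habs D (by omega)
    have h1 : (534 * ell D ^ 9) ^ 16 * ((D : ℝ))⁻¹ ≤ 1 := by
      rw [show (534 * ell D ^ 9) ^ 16 = 534 ^ 16 * ell D ^ 144 by ring]
      rw [mul_inv_le_iff₀ hD0, one_mul]
      exact habs'
    have hbase : 0 ≤ K * (X * bigP D ^ 2 * (D : ℝ) ^ (-(A : ℝ))) := by positivity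
    calc G * X * (534 * ell D ^ 9) ^ 16
        = K * (X * bigP D ^ 2 * (D : ℝ) ^ (-(A : ℝ))) * ((534 * ell D ^ 9) ^ 16 * ((D : ℝ))⁻¹) := by
          rw [hG, hsplit]; ring
      _ ≤ K * (X * bigP D ^ 2 * (D : ℝ) ^ (-(A : ℝ))) * 1 :=
          mul_le_mul_of_nonneg_left h1 hbase
      _ = _ := mul_one _
  have htail : 12 * Real.exp (15 * π) * C₀ * bigP D ≤
      12 * Real.exp (15 * π) * C₀ * (X * bigP D ^ 2 * (D : ℝ) ^ (-(A : ℝ))) := by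
    have hDA' : (D : ℝ) ^ A ≤ bigP D := hDA D (by omega)
    have hDApos : 0 < (D : ℝ) ^ A := pow_pos hD0 A
    have h1 : 1 ≤ bigP D * (D : ℝ) ^ (-(A : ℝ)) := by
      rw [Real.rpow_neg hD0.le, Real.rpow_natCast, ← div_eq_mul_inv, one_le_div hDApos]
      exact hDA'
    have h2 : bigP D ≤ X * bigP D ^ 2 * (D : ℝ) ^ (-(A : ℝ)) := by
      calc bigP D = 1 * bigP D * 1 := by ring
        _ ≤ X * bigP D * (bigP D * (D : ℝ) ^ (-(A : ℝ))) :=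
            mul_le_mul (mul_le_mul_of_nonneg_right hX1 hP0.le) h1 zero_le_one (by positivity)
        _ = X * bigP D ^ 2 * (D : ℝ) ^ (-(A : ℝ)) := by ring
    have hC₀0 : 0 ≤ 12 * Real.exp (15 * π) * C₀ := by positivity
    exact mul_le_mul_of_nonneg_left h2 hC₀0
  have hd4 : 0 ≤ B₀ * (d.divisors.card : ℝ) ^ 4 := by positivity
  calc ‖∑' l : ℕ, u l‖
      ≤ B₀ * (d.divisors.card : ℝ) ^ 4 *
          (G * X * (534 * ell D ^ 9) ^ 16 + 12 * Real.exp (15 * π) * C₀ * bigP D) := hmain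
    _ ≤ B₀ * (d.divisors.card : ℝ) ^ 4 * (K * (X * bigP D ^ 2 * (D : ℝ) ^ (-(A : ℝ))) +
          12 * Real.exp (15 * π) * C₀ * (X * bigP D ^ 2 * (D : ℝ) ^ (-(A : ℝ)))) :=
        mul_le_mul_of_nonneg_left (add_le_add hhead htail) hd4
    _ = B₀ * (K + 12 * Real.exp (15 * π) * C₀) * (d.divisors.card : ℝ) ^ 4 * X * bigP D ^ 2 *
          (D : ℝ) ^ (-(A : ℝ)) := by
        ring

/-! ## (14.8) twisted, first `r`-range: the aggregation over `d`, `r < D³`, `h`, `θ` -/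

/-- The harmonic bound on `Ico`: `Σ_{1 ≤ h < N} 1/h ≤ 1 + log N`. [folklore] -/
private theorem sum_Ico_one_div_le' (N : ℕ) : ∑ h ∈ Finset.Ico 1 N, (1 : ℝ) / h ≤ 1 + Real.log N := by
  calc ∑ h ∈ Finset.Ico 1 N, (1 : ℝ) / h ≤ ∑ h ∈ Finset.Icc 1 N, (1 : ℝ) / h :=
        Finset.sum_le_sum_of_subset_of_nonneg
          (fun h hh => by
            rw [Finset.mem_Ico] at hh; rw [Finset.mem_Icc]; omega)
          (fun _ _ _ => by positivity)
    _ ≤ 1 + Real.log N := sum_Icc_one_div_le_one_add_log N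

set_option maxHeartbeats 400000 in
/-- **`Z22:(14.8)` at general `β`, first `r`-range** (W-leg1 of the Prop. 14.1 work list; p. 76 "the
general case is almost identical", p. 79 tex L3960–L3962 "for `1 < r < D³` we use the Mellin transform,
Lemma 5.4 (i) and Lemma 5.6"): for every `B` there are `c > 0`, `C` with, for all large `D` under (A),
all `|β| < 5α` and all `κ*, a*` under (14.1)–(14.2),
`rhs1417OnW χ β κ* ((Icc 2 ⌊2DP₄⌋).filter (r < D³)) ≤ C·P²·D^{−c}` (the CLOSED `r`-range `Icc 2 ⌊2DP₄⌋`
of the weighted re-indexing; here `c = C = 1`). Same aggregation as `eq148leg1_holds` over the twisted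
per-character bound `smallConductor_tsum_le_wt` (`A = 9`). At `β = 0` this contains `Eq148leg1` on the
closed range (`rhs1417OnW_zero`). [cite: Zhang2022LandauSiegel, §14 Prop. 14.1 p.76; (14.8) p.79, tex L3945–L3962] -/
theorem eq148leg1W_holds :
    ∀ B : ℝ, ∃ c : ℝ, 0 < c ∧ ∃ C : ℝ, ForAllLarge fun D _ χ => AssumptionA D χ →
      ∀ β : ℂ, ‖β‖ < 5 * alpha D → ∀ κs as : ℕ → ℂ, Eq141 B κs → Eq142 D B as →
        rhs1417OnW χ β κs ((Finset.Icc 2 ⌊2 * (D : ℝ) * P4 D⌋₊).filter (fun r => r < D ^ 3))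
          ≤ C * bigP D ^ 2 * (D : ℝ) ^ (-c) := by
  classical
  intro B
  obtain ⟨C₀, hC₀0, DS, hS⟩ := smallConductor_tsum_le_wt 9 B
  obtain ⟨DP4, hP4⟩ := exists_two_mul_P4_le_bigP
  obtain ⟨Dℓ, hℓ2⟩ := exists_nat_forall_le_ell 2
  obtain ⟨Dabs, habs⟩ := exists_mul_ell_pow_le 171 (show (0 : ℝ) ≤ 12 * 2 ^ 16 * C₀ by positivity)
  refine ⟨1, one_pos, 1, DS + DP4 + Dℓ + Dabs + 3, fun D _ χ hD hq hp hA β hβ κs as hκ _ => ?_⟩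
  have hD3 : 3 ≤ D := by omega
  have hD0 : (0 : ℝ) < D := by exact_mod_cast (show 0 < D by omega)
  have hD1 : (1 : ℝ) ≤ D := by exact_mod_cast (show 1 ≤ D by omega)
  have hℓ2' : 2 ≤ ell D := hℓ2 D (by omega)
  have hℓ1 : 1 ≤ ell D := by linarith
  have hP0 : 0 < bigP D := Real.exp_pos _
  have hP1 : 1 ≤ bigP D := Real.one_le_exp (by positivity)
  have hlogP : Real.log (bigP D) = ell D ^ 9 := by rw [bigP, Real.log_exp]
  have h9 : (2 : ℝ) ≤ ell D ^ 9 := le_trans hℓ2' (le_self_pow₀ hℓ1 (by norm_num))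
  have hlog2 : Real.log 2 ≤ 1 := by
    have := Real.log_le_sub_one_of_pos (show (0 : ℝ) < 2 by norm_num); linarith
  set L : ℝ := ell D with hL
  set P : ℝ := bigP D with hPdef
  set Sr : Finset ℕ := (Finset.Icc 2 ⌊2 * (D : ℝ) * P4 D⌋₊).filter (fun r => r < D ^ 3) with hSr
  -- the per-character bound, as a function of `(d, h, r)`
  set BND : ℕ → ℕ → ℕ → ℝ := fun d h r =>
    C₀ * (d.divisors.card : ℝ) ^ 4 * ((h * r : ℕ) : ℝ) * P ^ 2 * (D : ℝ) ^ (-((9 : ℕ) : ℝ)) with hBND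
  have hBND0 : ∀ d h r, 0 ≤ BND d h r := fun d h r => by simp only [hBND]; positivity
  -- Step 1: one character
  have hchar : ∀ (d r h : ℕ) (θ : DirichletCharacter ℂ r), r ∈ Sr →
      h ∈ (Finset.Ico 1 ⌈bigP D / r⌉₊).filter (fun h => D / Nat.gcd D r ∣ h) →
      θ ∈ finsetOf {θ : DirichletCharacter ℂ r | θ.IsPrimitive ∧
          DirichletCharacter.changeLevel (dvd_mul_left r D) θ ≠
            DirichletCharacter.changeLevel (dvd_mul_right D r) χ} →
      ‖∑' l : ℕ, if Nat.Coprime l h then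
          κs (d * l) * θ (l : ZMod r) *
            ∑ p ∈ primeWindow D, χ (p : ZMod D) * θ⁻¹ (p : ZMod r) * wt D β p *
              DeltaW D ((l : ℝ) / ((p : ℝ) * h * r)) else 0‖ ≤ BND d h r := by
    intro d r h θ hr hh hθ
    obtain ⟨hr1, hr3⟩ := Finset.mem_filter.mp hr
    have hr2 : 2 ≤ r := (Finset.mem_Icc.mp hr1).1
    obtain ⟨hh1, -⟩ := Finset.mem_filter.mp hh
    obtain ⟨hh0, hhP⟩ := Finset.mem_Ico.mp hh1
    obtain ⟨hθp, hne⟩ := mem_of_mem_finsetOf hθ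
    have hr0 : (0 : ℝ) < r := by exact_mod_cast (show 0 < r by omega)
    have hrD : (r : ℝ) < (D : ℝ) ^ 3 := by exact_mod_cast hr3
    have hhr : ((h * r : ℕ) : ℝ) ≤ bigP D := by
      have h1 : (h : ℝ) < bigP D / r := Nat.lt_ceil.mp hhP
      rw [lt_div_iff₀ hr0] at h1
      push_cast; exact h1.le
    have hSeq : ∀ l : ℕ, (∑ p ∈ primeWindow D, χ (p : ZMod D) * θ⁻¹ (p : ZMod r) * wt D β p *
        DeltaW D ((l : ℝ) / ((p : ℝ) * h * r))) =
        ∑ p ∈ primeWindow D, χ (p : ZMod D) * θ⁻¹ (p : ZMod r) * wt D β p *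
          DeltaW D ((l : ℝ) / ((p : ℝ) * ((h * r : ℕ) : ℝ))) := by
      intro l
      refine Finset.sum_congr rfl fun p _ => ?_
      simp only [Nat.cast_mul, mul_assoc]
    refine hS D χ (by omega) hq hp hA β hβ.le κs hκ d r h θ (by omega) hrD (by omega) hhr hθp hne _ ?_
    intro l
    rw [← hSeq l]
    split_ifs with hc
    · rw [norm_mul, norm_mul]
      calc ‖κs (d * l)‖ * ‖θ (l : ZMod r)‖ * _ ≤ ‖κs (d * l)‖ * 1 * _ := by
            gcongr; exact DirichletCharacter.norm_le_one _ _
        _ = _ := by rw [mul_one]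
    · rw [norm_zero]; positivity
  -- Step 2: the sum over the characters at `(d, r, h)` is `≤ r · BND`
  have hθsum : ∀ (d r h : ℕ), r ∈ Sr →
      h ∈ (Finset.Ico 1 ⌈bigP D / r⌉₊).filter (fun h => D / Nat.gcd D r ∣ h) →
      (∑ θ ∈ finsetOf {θ : DirichletCharacter ℂ r | θ.IsPrimitive ∧
          DirichletCharacter.changeLevel (dvd_mul_left r D) θ ≠
            DirichletCharacter.changeLevel (dvd_mul_right D r) χ},
        ‖∑' l : ℕ, if Nat.Coprime l h then
            κs (d * l) * θ (l : ZMod r) *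
              ∑ p ∈ primeWindow D, χ (p : ZMod D) * θ⁻¹ (p : ZMod r) * wt D β p *
                DeltaW D ((l : ℝ) / ((p : ℝ) * h * r)) else 0‖) ≤ (r : ℝ) * BND d h r := by
    intro d r h hr hh
    have hr2 : 2 ≤ r := (Finset.mem_Icc.mp (Finset.mem_filter.mp hr).1).1
    haveI : NeZero r := ⟨by omega⟩
    set T := finsetOf {θ : DirichletCharacter ℂ r | θ.IsPrimitive ∧
          DirichletCharacter.changeLevel (dvd_mul_left r D) θ ≠
            DirichletCharacter.changeLevel (dvd_mul_right D r) χ} with hT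
    have h1 := Finset.sum_le_card_nsmul T _ (BND d h r) (fun θ hθ => hchar d r h θ hr hh hθ)
    rw [nsmul_eq_mul] at h1
    refine h1.trans (mul_le_mul_of_nonneg_right ?_ (hBND0 d h r))
    have hcard : T.card ≤ Fintype.card (DirichletCharacter ℂ r) := Finset.card_le_univ _
    have htot : Fintype.card (DirichletCharacter ℂ r) = r.totient := by
      rw [← Nat.card_eq_fintype_card, DirichletCharacter.card_eq_totient_of_hasEnoughRootsOfUnity ℂ r]
    calc (T.card : ℝ) ≤ (Fintype.card (DirichletCharacter ℂ r) : ℝ) := by exact_mod_cast hcard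
      _ = (r.totient : ℝ) := by rw [htot]
      _ ≤ r := by exact_mod_cast Nat.totient_le r
  -- Step 3: the weighted `(d, r, h)` term is `≤ M · d(d)⁴ · (1/h)`
  set M : ℝ := 4 * L ^ 18 * C₀ * P ^ 2 * (D : ℝ) ^ (-((9 : ℕ) : ℝ)) * (D : ℝ) * (D : ℝ) ^ 3 with hM
  have hM0 : 0 ≤ M := by positivity
  have hterm : ∀ (d r h : ℕ), r ∈ Sr →
      h ∈ (Finset.Ico 1 ⌈bigP D / r⌉₊).filter (fun h => D / Nat.gcd D r ∣ h) →
      (D : ℝ) / ((Nat.totient (h * r) : ℝ) * h * Real.sqrt r) * ((r : ℝ) * BND d h r) ≤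
        M * (d.divisors.card : ℝ) ^ 4 * (1 / (h : ℝ)) := by
    intro d r h hr hh
    obtain ⟨hr1, hr3⟩ := Finset.mem_filter.mp hr
    have hr2 : 2 ≤ r := (Finset.mem_Icc.mp hr1).1
    obtain ⟨hh1, -⟩ := Finset.mem_filter.mp hh
    obtain ⟨hh0, hhP⟩ := Finset.mem_Ico.mp hh1
    have hr0 : (0 : ℝ) < r := by exact_mod_cast (show 0 < r by omega)
    have hh0' : (0 : ℝ) < h := by exact_mod_cast hh0
    have hrD : (r : ℝ) ≤ (D : ℝ) ^ 3 := by exact_mod_cast hr3.le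
    have hhr0 : (0 : ℝ) < ((h * r : ℕ) : ℝ) := by exact_mod_cast Nat.mul_pos hh0 (by omega)
    have hhrP : ((h * r : ℕ) : ℝ) ≤ bigP D := by
      have h1 : (h : ℝ) < bigP D / r := Nat.lt_ceil.mp hhP
      rw [lt_div_iff₀ hr0] at h1
      push_cast; exact h1.le
    have htot0 : (0 : ℝ) < (Nat.totient (h * r) : ℝ) := by
      exact_mod_cast Nat.totient_pos.2 (Nat.mul_pos hh0 (by omega))
    have hsqrt1 : (1 : ℝ) ≤ Real.sqrt r := by
      rw [show (1 : ℝ) = Real.sqrt 1 from Real.sqrt_one.symm]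
      exact Real.sqrt_le_sqrt (by exact_mod_cast (show 1 ≤ r by omega))
    -- `hr ≤ 4𝓛¹⁸ φ(hr)`
    have hweight : ((h * r : ℕ) : ℝ) ≤ 4 * L ^ 18 * (Nat.totient (h * r) : ℝ) := by
      have hnat := Literature.NumberTheory.Sieve.natCast_div_totient_le (h * r)
      rw [div_le_iff₀ htot0] at hnat
      have hlog : Real.log ((h * r : ℕ) : ℝ) ≤ L ^ 9 := by
        calc Real.log ((h * r : ℕ) : ℝ) ≤ Real.log (bigP D) := Real.log_le_log hhr0 hhrP
          _ = L ^ 9 := hlogP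
      have hlog0 : 0 ≤ Real.log ((h * r : ℕ) : ℝ) := Real.log_natCast_nonneg _
      have h19 : (1 : ℝ) ≤ L ^ 9 := one_le_pow₀ hℓ1
      have hsq : (1 + Real.log ((h * r : ℕ) : ℝ)) ^ 2 ≤ 4 * L ^ 18 := by
        calc (1 + Real.log ((h * r : ℕ) : ℝ)) ^ 2 ≤ (2 * L ^ 9) ^ 2 :=
              pow_le_pow_left₀ (by linarith) (by linarith) 2
          _ = 4 * L ^ 18 := by ring
      exact hnat.trans (mul_le_mul_of_nonneg_right hsq htot0.le)
    -- the comparison, cleared of denominators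
    have hden : (0 : ℝ) < (Nat.totient (h * r) : ℝ) * h * Real.sqrt r := by positivity
    rw [div_mul_eq_mul_div, div_le_iff₀ hden]
    have hcore : (r : ℝ) * ((h * r : ℕ) : ℝ) * 1 ≤
        (D : ℝ) ^ 3 * (4 * L ^ 18 * (Nat.totient (h * r) : ℝ)) * Real.sqrt r :=
      mul_le_mul (mul_le_mul hrD hweight hhr0.le (by positivity)) hsqrt1 zero_le_one
        (by positivity)
    have hfac : 0 ≤ (D : ℝ) * C₀ * (d.divisors.card : ℝ) ^ 4 * P ^ 2 *
        (D : ℝ) ^ (-((9 : ℕ) : ℝ)) := by positivity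
    have hh1' : (1 / (h : ℝ)) * ((Nat.totient (h * r) : ℝ) * h * Real.sqrt r) =
        (Nat.totient (h * r) : ℝ) * Real.sqrt r := by
      field_simp
    calc (D : ℝ) * ((r : ℝ) * BND d h r)
        = ((D : ℝ) * C₀ * (d.divisors.card : ℝ) ^ 4 * P ^ 2 * (D : ℝ) ^ (-((9 : ℕ) : ℝ))) *
            ((r : ℝ) * ((h * r : ℕ) : ℝ) * 1) := by simp only [hBND]; ring
      _ ≤ ((D : ℝ) * C₀ * (d.divisors.card : ℝ) ^ 4 * P ^ 2 * (D : ℝ) ^ (-((9 : ℕ) : ℝ))) *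
            ((D : ℝ) ^ 3 * (4 * L ^ 18 * (Nat.totient (h * r) : ℝ)) * Real.sqrt r) :=
          mul_le_mul_of_nonneg_left hcore hfac
      _ = M * (d.divisors.card : ℝ) ^ 4 * ((Nat.totient (h * r) : ℝ) * Real.sqrt r) := by
          simp only [hM]; ring
      _ = M * (d.divisors.card : ℝ) ^ 4 * (1 / (h : ℝ)) *
            ((Nat.totient (h * r) : ℝ) * h * Real.sqrt r) := by
          rw [mul_assoc (M * (d.divisors.card : ℝ) ^ 4) (1 / (h : ℝ)), hh1']
  -- Step 4: the sum over `h` at fixed `(d, r)`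
  have hsumh : ∀ (d r : ℕ), r ∈ Sr →
      (∑ h ∈ (Finset.Ico 1 ⌈bigP D / r⌉₊).filter (fun h => D / Nat.gcd D r ∣ h),
        (D : ℝ) / ((Nat.totient (h * r) : ℝ) * h * Real.sqrt r) *
          ∑ θ ∈ finsetOf {θ : DirichletCharacter ℂ r | θ.IsPrimitive ∧
              DirichletCharacter.changeLevel (dvd_mul_left r D) θ ≠
                DirichletCharacter.changeLevel (dvd_mul_right D r) χ},
            ‖∑' l : ℕ, if Nat.Coprime l h then
                κs (d * l) * θ (l : ZMod r) *
                  ∑ p ∈ primeWindow D, χ (p : ZMod D) * θ⁻¹ (p : ZMod r) * wt D β p *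
                    DeltaW D ((l : ℝ) / ((p : ℝ) * h * r)) else 0‖) ≤
        M * (d.divisors.card : ℝ) ^ 4 * (3 * L ^ 9) := by
    intro d r hr
    have hr2 : 2 ≤ r := (Finset.mem_Icc.mp (Finset.mem_filter.mp hr).1).1
    have hr0 : (0 : ℝ) < r := by exact_mod_cast (show 0 < r by omega)
    set Hs := (Finset.Ico 1 ⌈bigP D / r⌉₊).filter (fun h => D / Nat.gcd D r ∣ h) with hHs
    calc (∑ h ∈ Hs, (D : ℝ) / ((Nat.totient (h * r) : ℝ) * h * Real.sqrt r) * _)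
        ≤ ∑ h ∈ Hs, (D : ℝ) / ((Nat.totient (h * r) : ℝ) * h * Real.sqrt r) * ((r : ℝ) * BND d h r) := by
          refine Finset.sum_le_sum fun h hh => ?_
          exact mul_le_mul_of_nonneg_left (hθsum d r h hr hh) (by positivity)
      _ ≤ ∑ h ∈ Hs, M * (d.divisors.card : ℝ) ^ 4 * (1 / (h : ℝ)) :=
          Finset.sum_le_sum fun h hh => hterm d r h hr hh
      _ ≤ ∑ h ∈ Finset.Ico 1 ⌈bigP D / r⌉₊, M * (d.divisors.card : ℝ) ^ 4 * (1 / (h : ℝ)) :=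
          Finset.sum_le_sum_of_subset_of_nonneg (Finset.filter_subset _ _)
            (fun _ _ _ => by positivity)
      _ = M * (d.divisors.card : ℝ) ^ 4 * ∑ h ∈ Finset.Ico 1 ⌈bigP D / r⌉₊, (1 / (h : ℝ)) := by
          rw [Finset.mul_sum]
      _ ≤ M * (d.divisors.card : ℝ) ^ 4 * (3 * L ^ 9) := by
          refine mul_le_mul_of_nonneg_left ?_ (by positivity)
          refine (sum_Ico_one_div_le' _).trans ?_
          -- `⌈P/r⌉ ≤ P/2 + 1 ≤ 2P`, `log(2P) ≤ 1 + 𝓛⁹`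
          have hceil : (⌈bigP D / r⌉₊ : ℝ) ≤ 2 * bigP D := by
            have h1 : (⌈bigP D / r⌉₊ : ℝ) < bigP D / r + 1 := Nat.ceil_lt_add_one (by positivity)
            have h2 : bigP D / r ≤ bigP D := div_le_self hP0.le (by exact_mod_cast (show 1 ≤ r by omega))
            linarith
          rcases Nat.eq_zero_or_pos ⌈bigP D / r⌉₊ with h0 | hpos
          · rw [h0]; simp; nlinarith
          · have hlog : Real.log (⌈bigP D / r⌉₊ : ℝ) ≤ Real.log 2 + L ^ 9 := by
              calc Real.log (⌈bigP D / r⌉₊ : ℝ) ≤ Real.log (2 * bigP D) :=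
                    Real.log_le_log (by exact_mod_cast hpos) hceil
                _ = Real.log 2 + L ^ 9 := by rw [Real.log_mul (by norm_num) hP0.ne', hlogP]
            linarith
  -- Step 5: the sum over `r ∈ Sr` (at most `D³` terms)
  have hcardSr : (Sr.card : ℝ) ≤ (D : ℝ) ^ 3 := by
    have h1 : Sr ⊆ Finset.range (D ^ 3) := fun r hr => by
      rw [Finset.mem_range]; exact (Finset.mem_filter.mp hr).2
    have h2 := Finset.card_le_card h1
    rw [Finset.card_range] at h2
    exact_mod_cast h2
  have hsumr : ∀ d : ℕ,
      (∑ r ∈ Sr, ∑ h ∈ (Finset.Ico 1 ⌈bigP D / r⌉₊).filter (fun h => D / Nat.gcd D r ∣ h),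
        (D : ℝ) / ((Nat.totient (h * r) : ℝ) * h * Real.sqrt r) *
          ∑ θ ∈ finsetOf {θ : DirichletCharacter ℂ r | θ.IsPrimitive ∧
              DirichletCharacter.changeLevel (dvd_mul_left r D) θ ≠
                DirichletCharacter.changeLevel (dvd_mul_right D r) χ},
            ‖∑' l : ℕ, if Nat.Coprime l h then
                κs (d * l) * θ (l : ZMod r) *
                  ∑ p ∈ primeWindow D, χ (p : ZMod D) * θ⁻¹ (p : ZMod r) * wt D β p *
                    DeltaW D ((l : ℝ) / ((p : ℝ) * h * r)) else 0‖) ≤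
        (D : ℝ) ^ 3 * (M * (d.divisors.card : ℝ) ^ 4 * (3 * L ^ 9)) := by
    intro d
    have h1 := Finset.sum_le_card_nsmul Sr _ (M * (d.divisors.card : ℝ) ^ 4 * (3 * L ^ 9))
      (fun r hr => hsumh d r hr)
    rw [nsmul_eq_mul] at h1
    exact h1.trans (mul_le_mul_of_nonneg_right hcardSr (by positivity))
  -- Step 6: the sum over `d`
  have hlog2P4 : 1 + Real.log (⌊2 * P4 D⌋₊ : ℝ) ≤ 2 * L ^ 9 := by
    have hP4' : 2 * P4 D ≤ bigP D := hP4 D (by omega)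
    rcases Nat.eq_zero_or_pos ⌊2 * P4 D⌋₊ with h0 | hpos
    · rw [h0]; simp; linarith
    · have hT0 : 0 < bigT D := Real.exp_pos _
      have ht00 : 0 ≤ t0 D := by rw [t0]; exact pow_nonneg (by linarith) _
      have h2P4 : 0 ≤ 2 * P4 D := by rw [P4]; positivity
      have hfl : (⌊2 * P4 D⌋₊ : ℝ) ≤ bigP D := (Nat.floor_le h2P4).trans hP4'
      have : Real.log (⌊2 * P4 D⌋₊ : ℝ) ≤ L ^ 9 := by
        rw [← hlogP]; exact Real.log_le_log (by exact_mod_cast hpos) hfl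
      linarith
  have hsumd : ∑ d ∈ Finset.Icc 1 ⌊2 * P4 D⌋₊, (d : ℝ)⁻¹ *
      ((D : ℝ) ^ 3 * (M * (d.divisors.card : ℝ) ^ 4 * (3 * L ^ 9))) ≤
      (D : ℝ) ^ 3 * M * (3 * L ^ 9) * (2 * L ^ 9) ^ 16 := by
    have e1 : ∑ d ∈ Finset.Icc 1 ⌊2 * P4 D⌋₊, (d : ℝ)⁻¹ *
        ((D : ℝ) ^ 3 * (M * (d.divisors.card : ℝ) ^ 4 * (3 * L ^ 9))) =
        (D : ℝ) ^ 3 * M * (3 * L ^ 9) *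
          ∑ d ∈ Finset.Icc 1 ⌊2 * P4 D⌋₊, (d.divisors.card : ℝ) ^ 4 / d := by
      rw [Finset.mul_sum]
      exact Finset.sum_congr rfl fun d _ => by rw [div_eq_mul_inv]; ring
    rw [e1]
    refine mul_le_mul_of_nonneg_left ?_ (by positivity)
    calc ∑ d ∈ Finset.Icc 1 ⌊2 * P4 D⌋₊, (d.divisors.card : ℝ) ^ 4 / d
        ≤ (1 + Real.log (⌊2 * P4 D⌋₊ : ℝ)) ^ (2 ^ 4) := sum_card_divisors_pow_div_le_log_pow 4 _
      _ = (1 + Real.log (⌊2 * P4 D⌋₊ : ℝ)) ^ 16 := by norm_num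
      _ ≤ (2 * L ^ 9) ^ 16 := by
          refine pow_le_pow_left₀ ?_ hlog2P4 16
          have : 0 ≤ Real.log (⌊2 * P4 D⌋₊ : ℝ) := Real.log_natCast_nonneg _
          linarith
  -- Step 7: assembling and absorbing the powers of `𝓛`
  have hfinal : (D : ℝ) ^ 3 * M * (3 * L ^ 9) * (2 * L ^ 9) ^ 16 ≤
      1 * bigP D ^ 2 * (D : ℝ) ^ (-(1 : ℝ)) := by
    have habs' : 12 * 2 ^ 16 * C₀ * L ^ 171 ≤ D := habs D (by omega)
    have e9 : (D : ℝ) ^ (-((9 : ℕ) : ℝ)) = ((D : ℝ) ^ 9)⁻¹ := by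
      rw [Real.rpow_neg hD0.le, Real.rpow_natCast]
    have e1 : (D : ℝ) ^ (-(1 : ℝ)) = ((D : ℝ))⁻¹ := Real.rpow_neg_one _
    have eLHS : (D : ℝ) ^ 3 * M * (3 * L ^ 9) * (2 * L ^ 9) ^ 16 =
        (12 * 2 ^ 16 * C₀ * L ^ 171) * P ^ 2 * ((D : ℝ) ^ 7 * ((D : ℝ) ^ 9)⁻¹) := by
      simp only [hM]; rw [e9]; ring
    have e7 : (D : ℝ) ^ 7 * ((D : ℝ) ^ 9)⁻¹ = ((D : ℝ) ^ 2)⁻¹ := by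
      field_simp
    rw [eLHS, e7, e1, one_mul]
    -- goal: `K 𝓛¹⁷¹ · P² · (D²)⁻¹ ≤ P² · D⁻¹`
    have hD2 : (0 : ℝ) < (D : ℝ) ^ 2 := by positivity
    rw [show bigP D ^ 2 * ((D : ℝ))⁻¹ = (bigP D ^ 2 * D) * ((D : ℝ) ^ 2)⁻¹ by
      field_simp]
    refine mul_le_mul_of_nonneg_right ?_ (by positivity)
    calc 12 * 2 ^ 16 * C₀ * L ^ 171 * P ^ 2 = P ^ 2 * (12 * 2 ^ 16 * C₀ * L ^ 171) := by ring
      _ ≤ P ^ 2 * D := mul_le_mul_of_nonneg_left habs' (by positivity)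
      _ = bigP D ^ 2 * D := by rw [hPdef]
  -- the chain
  unfold rhs1417OnW
  calc ∑ d ∈ Finset.Icc 1 ⌊2 * P4 D⌋₊, (d : ℝ)⁻¹ * ∑ r ∈ Sr,
        ∑ h ∈ (Finset.Ico 1 ⌈bigP D / r⌉₊).filter (fun h => D / Nat.gcd D r ∣ h),
          (D : ℝ) / ((Nat.totient (h * r) : ℝ) * h * Real.sqrt r) *
            ∑ θ ∈ finsetOf {θ : DirichletCharacter ℂ r | θ.IsPrimitive ∧
                DirichletCharacter.changeLevel (dvd_mul_left r D) θ ≠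
                  DirichletCharacter.changeLevel (dvd_mul_right D r) χ},
              ‖∑' l : ℕ, if Nat.Coprime l h then
                  κs (d * l) * θ (l : ZMod r) *
                    ∑ p ∈ primeWindow D, χ (p : ZMod D) * θ⁻¹ (p : ZMod r) * wt D β p *
                      DeltaW D ((l : ℝ) / ((p : ℝ) * h * r)) else 0‖
      ≤ ∑ d ∈ Finset.Icc 1 ⌊2 * P4 D⌋₊, (d : ℝ)⁻¹ *
          ((D : ℝ) ^ 3 * (M * (d.divisors.card : ℝ) ^ 4 * (3 * L ^ 9))) := by
        refine Finset.sum_le_sum fun d _ => ?_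
        exact mul_le_mul_of_nonneg_left (hsumr d) (by positivity)
    _ ≤ (D : ℝ) ^ 3 * M * (3 * L ^ 9) * (2 * L ^ 9) ^ 16 := hsumd
    _ ≤ 1 * bigP D ^ 2 * (D : ℝ) ^ (-(1 : ℝ)) := hfinal

end Literature.NumberTheory.LFunctions.Zhang2022.Typed.Sec14
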